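import Mathlib
import HarnessLib
import Literature.MathematicalPhysics.StatisticalMechanics.StrongNormExp
import Literature.MathematicalPhysics.StatisticalMechanics.StrongNormExpLipschitz
import Literature.MathematicalPhysics.StatisticalMechanics.StrongWeightABKM
import Literature.MathematicalPhysics.StatisticalMechanics.LinearisedMapOpB

/-!
# Two more strong-norm atoms of the exponential map ([ABKM19] Lemma 9.3 / Lemma 8.9):
# `‖H(B)‖_{T,W} ≤ 8‖H‖_{k,0}` and `‖(e^{H₁(B)} − e^{H₂(B)})(e^{H₃(B)} − 1)‖_{T,W} ≤ 256e^{1/4}‖H₁−H₂‖_{k,0}‖H₃‖_{k,0}`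

Companions of `StrongNormExp`, `StrongNormExpProduct`, `StrongNormExpSecond`, `StrongNormExpLipschitz`
(the one-block atoms of the Lipschitz estimate of the renormalisation map, [ABKM19] Theorem 6.8 /
Lemma 9.6): for an `ℓ²`-dominating weight `W` (`Ell2Dominates B 𝔥 R W`: `e^{N(φ)²/2} ≤ W(φ)` where
`N(φ)` dominates the normalised `ℓ²(B)` norms of the derivatives of `φ`),

* **`tayNormLE_eval_ell2`** — the polynomial functional `H(B)` of a relevant Hamiltonian is in the
  strong norm with `‖H(B)‖_{T,W} ≤ 8‖H‖_{k,0}` (Lemma 8.9: `|H(B)|_{T_φ} ≤ (1+N²)·2‖H‖_{k,0}` and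
  `1 + N² ≤ 4e^{N²/4}`); no smallness needed;
* **`tayNormLE_cexp_eval_sub_mul_sub_one`** — the mixed Lipschitz/product atom
  `‖(e^{H₁(B)} − e^{H₂(B)})(e^{H₃(B)} − 1)‖_{T,W} ≤ 256e^{1/4}‖H₁ − H₂‖_{k,0}‖H₃‖_{k,0}` for
  `‖Hᵢ‖_{k,0} ≤ 1/32` (factorisation `e^{H₂}(e^{H₁−H₂} − 1)(e^{H₃} − 1)` and
  `‖e^F − 1‖_{T_φ} ≤ ‖F‖_{T_φ}e^{‖F‖_{T_φ}}`), with the Boltzmann-sign version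
  `tayNormLE_cexp_neg_eval_sub_mul_sub_one`;
* **`tayNormLE_eval_strong_abkm`**, **`tayNormLE_expNegH_sub_mul_sub_one_strong_abkm`** — the same for
  the strong weight `W_k^B` of the torus tower on a block `B = B_x`.

Everything is proved; no named fact.

## References
* S. Adams, S. Buchholz, R. Kotecký, S. Müller, arXiv:1910.13564, Lemma 9.3 ((9.13)–(9.16)),
  Lemma 8.9 [AdamsBuchholzKoteckyMuller2019].
* R. Bauerschmidt, D. Brydges, G. Slade, LNM 2242 (2019), Lemma 7.4.1 [BauerschmidtBrydgesSlade2019RG].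
-/

noncomputable section

namespace Literature.MathematicalPhysics.StatisticalMechanics.GradientRG

open scoped BigOperators
open Finset
open Literature.MathematicalPhysics.QuantumFieldTheory
open Literature.MathematicalPhysics.StatisticalMechanics.TorusPolymer (blockOf)

variable {d M : ℕ} [NeZero M]

/-- `1 + N² ≤ 4 e^{N²/2}`. [folklore] -/
private theorem one_add_sq_le_four_mul_exp_half (N : ℝ) : 1 + N ^ 2 ≤ 4 * Real.exp (N ^ 2 / 2) := by
  have h1 := Real.add_one_le_exp (N ^ 2 / 2)
  nlinarith [sq_nonneg N, Real.exp_pos (N ^ 2 / 2)]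

/-- `(1 + N²)² ≤ 64 e^{N²/4}`. [folklore] -/
private theorem one_add_sq_sq_le_exp_quarter (N : ℝ) : (1 + N ^ 2) ^ 2 ≤ 64 * Real.exp (N ^ 2 / 4) := by
  have h1 : 1 + N ^ 2 ≤ 8 * Real.exp (N ^ 2 / 8) := by
    have := Real.add_one_le_exp (N ^ 2 / 8)
    nlinarith [sq_nonneg N]
  have h0 : 0 ≤ 1 + N ^ 2 := by positivity
  have hsq : Real.exp (N ^ 2 / 8) * Real.exp (N ^ 2 / 8) = Real.exp (N ^ 2 / 4) := by
    rw [← Real.exp_add]; ring_nf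
  calc (1 + N ^ 2) ^ 2 ≤ (8 * Real.exp (N ^ 2 / 8)) ^ 2 := pow_le_pow_left₀ h0 h1 2
    _ = 64 * Real.exp (N ^ 2 / 4) := by rw [mul_pow, ← hsq]; ring

/-! ## The polynomial functional `H(B)` in the strong norm -/

/-- **`‖H(B)‖_{T, W} ≤ 8‖H‖_{k,0}`** for an `ℓ²`-dominating weight `W` and ANY relevant Hamiltonian `H`
([ABKM19] Lemma 8.9 in the strong norm: `|H(B)|_{T_φ} ≤ (1 + N(φ)²)·2‖H‖_{k,0} ≤ 8‖H‖_{k,0} e^{N(φ)²/2}`).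
[cite: AdamsBuchholzKoteckyMuller2019, Lemma 8.9 / Lemma 9.3 (9.15)] -/
theorem tayNormLE_eval_ell2 {𝔥 R : ℝ} (h𝔥 : 0 < 𝔥) (hR : 0 < R) {p : ℕ} (hp : d / 2 + 1 ≤ p)
    {S B : Finset (Fin d → ZMod M)} (hBS : B ⊆ S) {W : ((Fin d → ZMod M) → ℝ) → ℝ}
    (hW : Ell2Dominates B 𝔥 R W) (H : RelevantHamiltonian ℂ d) (r₀ : ℕ) :
    TayNormLE (fieldGauge 𝔥 R p S) r₀ W (fun ψ : (Fin d → ZMod M) → ℝ => eval H B ψ)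
      (8 * hamNorm 𝔥 R B.card H) := by
  intro φ
  obtain ⟨N, hN0, hNlin, hNgrad, hNW⟩ := hW φ
  have hH0 : 0 ≤ hamNorm 𝔥 R B.card H := hamNorm_nonneg h𝔥.le hR.le _ _
  have h1 := tayNorm_eval_le_quarter (𝕜 := ℂ) h𝔥 hR hp hBS (H := H) (r₀ := r₀) hN0 hNlin hNgrad
  have hq := one_add_sq_le_four_mul_exp_half N
  calc tayNorm (fieldGauge 𝔥 R p S) r₀ (fun ψ : (Fin d → ZMod M) → ℝ => eval H B ψ) φ
      ≤ (1 + N ^ 2) * (2 * hamNorm 𝔥 R B.card H) := h1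
    _ ≤ (4 * Real.exp (N ^ 2 / 2)) * (2 * hamNorm 𝔥 R B.card H) :=
        mul_le_mul_of_nonneg_right hq (by positivity)
    _ = 8 * hamNorm 𝔥 R B.card H * Real.exp (N ^ 2 / 2) := by ring
    _ ≤ 8 * hamNorm 𝔥 R B.card H * W φ := mul_le_mul_of_nonneg_left hNW (by positivity)

/-- **`‖H(B)‖_{T, W_k^B} ≤ 8‖H‖_{k,0}` for the torus tower** on the block `B = B_x` at scale `k ≤ N`
(`L` odd, `M = L^N`, `h > 0`, `⌊d/2⌋+1 ≤ min(p, M_ord)`, gauge `fieldGauge 𝔥_k L^k p S` with `B ⊆ S`).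
[cite: AdamsBuchholzKoteckyMuller2019, Lemma 8.9 / Lemma 9.3 (9.15)] -/
theorem tayNormLE_eval_strong_abkm {L N Mord R k p : ℕ} {h : ℝ} (hd : 2 ≤ d) (hLodd : Odd L)
    (hM : M = L ^ N) (hk : k ≤ N) (hh : 0 < h) (hMord : d / 2 + 1 ≤ Mord) (hp : d / 2 + 1 ≤ p)
    {x : Fin d → ZMod M} {S : Finset (Fin d → ZMod M)} (hBS : blockOf (L ^ k) x ⊆ S)
    (H : RelevantHamiltonian ℂ d) (r₀ : ℕ) :
    TayNormLE (fieldGauge (fieldWt h (L : ℝ) d k) ((L : ℝ) ^ k) p S) r₀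
      (expWeight (strongCoef h N k • derivForm (L : ℝ) k (diffIndex d Mord)
        (boxDensity (boxRad R L k) (boxWt (L : ℝ) d k) (blockOf (L ^ k) x))))
      (fun ψ : (Fin d → ZMod M) → ℝ => eval H (blockOf (L ^ k) x) ψ)
      (8 * hamNorm (fieldWt h (L : ℝ) d k) ((L : ℝ) ^ k) (blockOf (L ^ k) x).card H) := by
  have hL0 : (0 : ℝ) < L := by exact_mod_cast hLodd.pos
  exact tayNormLE_eval_ell2 (fieldWt_pos hh hL0 d k) (by positivity) hp hBS
    (ell2Dominates_strongWeight_abkm (R := R) hd hLodd hM hk hh hMord x) H r₀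

/-! ## The mixed atom `(e^{H₁(B)} − e^{H₂(B)})(e^{H₃(B)} − 1)` -/

/-- **`‖(e^{H₁(B)} − e^{H₂(B)})(e^{H₃(B)} − 1)‖_{T, W} ≤ 256e^{1/4}‖H₁ − H₂‖_{k,0}‖H₃‖_{k,0}`** for an
`ℓ²`-dominating weight `W` and `‖H₁‖_{k,0}, ‖H₂‖_{k,0}, ‖H₃‖_{k,0} ≤ 1/32`: the product is
`e^{H₂}·(e^{H₁−H₂} − 1)·(e^{H₃} − 1)`, each factor is bounded by Lemma 8.9 and
`‖e^F‖_{T_φ} ≤ e^{‖F‖_{T_φ}}`, `‖e^F − 1‖_{T_φ} ≤ ‖F‖_{T_φ}e^{‖F‖_{T_φ}}`; the three exponentials use up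
`e^{1/4}e^{N²/4}` and `(1+N²)² ≤ 64e^{N²/4}`. [cite: AdamsBuchholzKoteckyMuller2019, Lemma 9.3 (9.13)] -/
theorem tayNormLE_cexp_eval_sub_mul_sub_one {𝔥 R : ℝ} (h𝔥 : 0 < 𝔥) (hR : 0 < R) {p : ℕ}
    (hp : d / 2 + 1 ≤ p) {S B : Finset (Fin d → ZMod M)} (hBS : B ⊆ S)
    {W : ((Fin d → ZMod M) → ℝ) → ℝ} (hW : Ell2Dominates B 𝔥 R W) {H₁ H₂ H₃ : RelevantHamiltonian ℂ d}
    (r₀ : ℕ) (hH₁ : hamNorm 𝔥 R B.card H₁ ≤ 1 / 32) (hH₂ : hamNorm 𝔥 R B.card H₂ ≤ 1 / 32)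
    (hH₃ : hamNorm 𝔥 R B.card H₃ ≤ 1 / 32) :
    TayNormLE (fieldGauge 𝔥 R p S) r₀ W
      (fun ψ : (Fin d → ZMod M) → ℝ =>
        (Complex.exp (eval H₁ B ψ) - Complex.exp (eval H₂ B ψ)) * (Complex.exp (eval H₃ B ψ) - 1))
      (256 * Real.exp (1 / 4) * hamNorm 𝔥 R B.card (H₁ - H₂) * hamNorm 𝔥 R B.card H₃) := by
  intro φ
  obtain ⟨N, hN0, hNlin, hNgrad, hNW⟩ := hW φ
  set T := fieldGauge 𝔥 R p S with hT
  set nΔ := hamNorm 𝔥 R B.card (H₁ - H₂) with hnΔ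
  set n₂ := hamNorm 𝔥 R B.card H₂ with hn₂
  set n₃ := hamNorm 𝔥 R B.card H₃ with hn₃
  have hnΔ0 : 0 ≤ nΔ := hamNorm_nonneg h𝔥.le hR.le _ _
  have hn₂0 : 0 ≤ n₂ := hamNorm_nonneg h𝔥.le hR.le _ _
  have hn₃0 : 0 ≤ n₃ := hamNorm_nonneg h𝔥.le hR.le _ _
  have hnΔle : nΔ ≤ 1 / 16 := (hamNorm_sub_le h𝔥.le hR.le _ H₁ H₂).trans (by linarith)
  -- the factorisation `(e^{H₁} − e^{H₂})(e^{H₃} − 1) = e^{H₂}·((e^{H₁−H₂} − 1)(e^{H₃} − 1))`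
  have hfac : (fun ψ : (Fin d → ZMod M) → ℝ =>
      (Complex.exp (eval H₁ B ψ) - Complex.exp (eval H₂ B ψ)) * (Complex.exp (eval H₃ B ψ) - 1)) =
      (fun ψ => Complex.exp (eval H₂ B ψ)) *
        ((fun ψ => Complex.exp (eval (H₁ - H₂) B ψ) - 1) * fun ψ => Complex.exp (eval H₃ B ψ) - 1) := by
    funext ψ
    simp only [Pi.mul_apply, eval_sub]
    have : Complex.exp (eval H₁ B ψ) - Complex.exp (eval H₂ B ψ) =
        Complex.exp (eval H₂ B ψ) * (Complex.exp (eval H₁ B ψ - eval H₂ B ψ) - 1) := by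
      rw [mul_sub, mul_one, ← Complex.exp_add, add_sub_cancel]
    rw [this, mul_assoc]
  rw [hfac]
  have hGd : ContDiff ℝ r₀ (fun ψ : (Fin d → ZMod M) → ℝ => Complex.exp (eval H₂ B ψ)) :=
    (contDiff_eval H₂ B).cexp
  have hDd : ContDiff ℝ r₀ (fun ψ : (Fin d → ZMod M) → ℝ => Complex.exp (eval (H₁ - H₂) B ψ) - 1) :=
    (contDiff_eval (H₁ - H₂) B).cexp.sub contDiff_const
  have h3d : ContDiff ℝ r₀ (fun ψ : (Fin d → ZMod M) → ℝ => Complex.exp (eval H₃ B ψ) - 1) :=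
    (contDiff_eval H₃ B).cexp.sub contDiff_const
  refine (tayNorm_mul_le T hGd (hDd.mul h3d) φ).trans ?_
  refine (mul_le_mul_of_nonneg_left (tayNorm_mul_le T hDd h3d φ) (tayNorm_nonneg _ _ _ _)).trans ?_
  -- the three factors
  set tG := tayNorm T r₀ (fun ψ : (Fin d → ZMod M) → ℝ => eval H₂ B ψ) φ with htG
  set tD := tayNorm T r₀ (fun ψ : (Fin d → ZMod M) → ℝ => eval (H₁ - H₂) B ψ) φ with htD
  set t₃ := tayNorm T r₀ (fun ψ : (Fin d → ZMod M) → ℝ => eval H₃ B ψ) φ with ht₃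
  have htG0 : 0 ≤ tG := tayNorm_nonneg _ _ _ _
  have htD0 : 0 ≤ tD := tayNorm_nonneg _ _ _ _
  have ht₃0 : 0 ≤ t₃ := tayNorm_nonneg _ _ _ _
  have h1 : tayNorm T r₀ (fun ψ : (Fin d → ZMod M) → ℝ => Complex.exp (eval H₂ B ψ)) φ ≤ Real.exp tG :=
    tayNorm_cexp_le_exp T (contDiff_eval H₂ B (n := r₀)) φ
  have h2 : tayNorm T r₀ (fun ψ : (Fin d → ZMod M) → ℝ => Complex.exp (eval (H₁ - H₂) B ψ) - 1) φ ≤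
      tD * Real.exp tD := tayNorm_cexp_sub_one_le T (contDiff_eval (H₁ - H₂) B (n := r₀)) φ
  have h3 : tayNorm T r₀ (fun ψ : (Fin d → ZMod M) → ℝ => Complex.exp (eval H₃ B ψ) - 1) φ ≤
      t₃ * Real.exp t₃ := tayNorm_cexp_sub_one_le T (contDiff_eval H₃ B (n := r₀)) φ
  have hG1 : tG ≤ (1 + N ^ 2) * (2 * n₂) :=
    tayNorm_eval_le_quarter (𝕜 := ℂ) h𝔥 hR hp hBS (H := H₂) (r₀ := r₀) hN0 hNlin hNgrad
  have hD1 : tD ≤ (1 + N ^ 2) * (2 * nΔ) :=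
    tayNorm_eval_le_quarter (𝕜 := ℂ) h𝔥 hR hp hBS (H := H₁ - H₂) (r₀ := r₀) hN0 hNlin hNgrad
  have h31 : t₃ ≤ (1 + N ^ 2) * (2 * n₃) :=
    tayNorm_eval_le_quarter (𝕜 := ℂ) h𝔥 hR hp hBS (H := H₃) (r₀ := r₀) hN0 hNlin hNgrad
  have hN2 : 0 ≤ 1 + N ^ 2 := by positivity
  have hG2 : tG ≤ (1 + N ^ 2) / 16 := by
    have := mul_le_mul_of_nonneg_left (show 2 * n₂ ≤ 2 * (1 / 32) by linarith) hN2
    linarith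
  have hD2 : tD ≤ (1 + N ^ 2) / 8 := by
    have := mul_le_mul_of_nonneg_left (show 2 * nΔ ≤ 2 * (1 / 16) by linarith) hN2
    linarith
  have h32 : t₃ ≤ (1 + N ^ 2) / 16 := by
    have := mul_le_mul_of_nonneg_left (show 2 * n₃ ≤ 2 * (1 / 32) by linarith) hN2
    linarith
  have hq := one_add_sq_sq_le_exp_quarter N
  have hexp : Real.exp tG * Real.exp tD * Real.exp t₃ ≤ Real.exp (1 / 4) * Real.exp (N ^ 2 / 4) := by
    rw [← Real.exp_add, ← Real.exp_add, ← Real.exp_add]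
    exact Real.exp_le_exp.2 (by linarith)
  have hsq : Real.exp (N ^ 2 / 4) * Real.exp (N ^ 2 / 4) = Real.exp (N ^ 2 / 2) := by
    rw [← Real.exp_add]; ring_nf
  have htt : tD * t₃ ≤ (1 + N ^ 2) ^ 2 * (4 * (nΔ * n₃)) := by
    calc tD * t₃ ≤ ((1 + N ^ 2) * (2 * nΔ)) * ((1 + N ^ 2) * (2 * n₃)) :=
          mul_le_mul hD1 h31 ht₃0 (mul_nonneg hN2 (by linarith))
      _ = (1 + N ^ 2) ^ 2 * (4 * (nΔ * n₃)) := by ring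
  have h23 : tayNorm T r₀ (fun ψ : (Fin d → ZMod M) → ℝ => Complex.exp (eval (H₁ - H₂) B ψ) - 1) φ *
      tayNorm T r₀ (fun ψ : (Fin d → ZMod M) → ℝ => Complex.exp (eval H₃ B ψ) - 1) φ ≤
      (tD * Real.exp tD) * (t₃ * Real.exp t₃) :=
    mul_le_mul h2 h3 (tayNorm_nonneg _ _ _ _) (mul_nonneg htD0 (Real.exp_pos _).le)
  refine (mul_le_mul h1 h23 (mul_nonneg (tayNorm_nonneg _ _ _ _) (tayNorm_nonneg _ _ _ _))
    (Real.exp_pos _).le).trans ?_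
  calc Real.exp tG * (tD * Real.exp tD * (t₃ * Real.exp t₃))
      = (tD * t₃) * (Real.exp tG * Real.exp tD * Real.exp t₃) := by ring
    _ ≤ ((1 + N ^ 2) ^ 2 * (4 * (nΔ * n₃))) * (Real.exp (1 / 4) * Real.exp (N ^ 2 / 4)) :=
        mul_le_mul htt hexp (by positivity) (by positivity)
    _ ≤ (64 * Real.exp (N ^ 2 / 4) * (4 * (nΔ * n₃))) * (Real.exp (1 / 4) * Real.exp (N ^ 2 / 4)) := by
        gcongr
    _ = 256 * Real.exp (1 / 4) * nΔ * n₃ * (Real.exp (N ^ 2 / 4) * Real.exp (N ^ 2 / 4)) := by ring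
    _ = 256 * Real.exp (1 / 4) * nΔ * n₃ * Real.exp (N ^ 2 / 2) := by rw [hsq]
    _ ≤ 256 * Real.exp (1 / 4) * nΔ * n₃ * W φ := mul_le_mul_of_nonneg_left hNW (by positivity)

/-- **Boltzmann-sign version**: `‖(e^{−H₁(B)} − e^{−H₂(B)})(e^{−H₃(B)} − 1)‖_{T, W} ≤ 256e^{1/4}‖H₁ − H₂‖_{k,0}‖H₃‖_{k,0}`
for `‖Hᵢ‖_{k,0} ≤ 1/32`. [cite: AdamsBuchholzKoteckyMuller2019, Lemma 9.3 (9.13)] -/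
theorem tayNormLE_cexp_neg_eval_sub_mul_sub_one {𝔥 R : ℝ} (h𝔥 : 0 < 𝔥) (hR : 0 < R) {p : ℕ}
    (hp : d / 2 + 1 ≤ p) {S B : Finset (Fin d → ZMod M)} (hBS : B ⊆ S)
    {W : ((Fin d → ZMod M) → ℝ) → ℝ} (hW : Ell2Dominates B 𝔥 R W) {H₁ H₂ H₃ : RelevantHamiltonian ℂ d}
    (r₀ : ℕ) (hH₁ : hamNorm 𝔥 R B.card H₁ ≤ 1 / 32) (hH₂ : hamNorm 𝔥 R B.card H₂ ≤ 1 / 32)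
    (hH₃ : hamNorm 𝔥 R B.card H₃ ≤ 1 / 32) :
    TayNormLE (fieldGauge 𝔥 R p S) r₀ W
      (fun ψ : (Fin d → ZMod M) → ℝ =>
        (Complex.exp (-(eval H₁ B ψ)) - Complex.exp (-(eval H₂ B ψ))) * (Complex.exp (-(eval H₃ B ψ)) - 1))
      (256 * Real.exp (1 / 4) * hamNorm 𝔥 R B.card (H₁ - H₂) * hamNorm 𝔥 R B.card H₃) := by
  have hfun : (fun ψ : (Fin d → ZMod M) → ℝ =>
      (Complex.exp (-(eval H₁ B ψ)) - Complex.exp (-(eval H₂ B ψ))) * (Complex.exp (-(eval H₃ B ψ)) - 1)) =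
      fun ψ => (Complex.exp (eval (-H₁) B ψ) - Complex.exp (eval (-H₂) B ψ)) *
        (Complex.exp (eval (-H₃) B ψ) - 1) := by
    funext ψ; rw [eval_neg, eval_neg, eval_neg]
  have hnorm : hamNorm 𝔥 R B.card (-H₁ - -H₂) = hamNorm 𝔥 R B.card (H₁ - H₂) := by
    rw [show -H₁ - -H₂ = -(H₁ - H₂) by abel, hamNorm_neg]
  rw [hfun, ← hnorm, ← hamNorm_neg 𝔥 R B.card H₃]
  exact tayNormLE_cexp_eval_sub_mul_sub_one h𝔥 hR hp hBS hW r₀ (by rwa [hamNorm_neg]) (by rwa [hamNorm_neg])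
    (by rwa [hamNorm_neg])

/-- **The mixed atom for the torus tower**: on the block `B = B_x` at scale `k ≤ N`, with the strong
weight `W_k^B` and `‖Hᵢ‖_{k,0} ≤ 1/32` (at `(𝔥_k, L^k, |B|)`):
`‖(e^{−H₁(B)} − e^{−H₂(B)})(e^{−H₃(B)} − 1)‖_{T, W_k^B} ≤ 256e^{1/4}‖H₁ − H₂‖_{k,0}‖H₃‖_{k,0}`.
[cite: AdamsBuchholzKoteckyMuller2019, Lemma 9.3 (9.13)] -/
theorem tayNormLE_expNegH_sub_mul_sub_one_strong_abkm {L N Mord R k p : ℕ} {h : ℝ} (hd : 2 ≤ d)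
    (hLodd : Odd L) (hM : M = L ^ N) (hk : k ≤ N) (hh : 0 < h) (hMord : d / 2 + 1 ≤ Mord)
    (hp : d / 2 + 1 ≤ p) {x : Fin d → ZMod M} {S : Finset (Fin d → ZMod M)}
    (hBS : blockOf (L ^ k) x ⊆ S) {H₁ H₂ H₃ : RelevantHamiltonian ℂ d} (r₀ : ℕ)
    (hH₁ : hamNorm (fieldWt h (L : ℝ) d k) ((L : ℝ) ^ k) (blockOf (L ^ k) x).card H₁ ≤ 1 / 32)
    (hH₂ : hamNorm (fieldWt h (L : ℝ) d k) ((L : ℝ) ^ k) (blockOf (L ^ k) x).card H₂ ≤ 1 / 32)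
    (hH₃ : hamNorm (fieldWt h (L : ℝ) d k) ((L : ℝ) ^ k) (blockOf (L ^ k) x).card H₃ ≤ 1 / 32) :
    TayNormLE (fieldGauge (fieldWt h (L : ℝ) d k) ((L : ℝ) ^ k) p S) r₀
      (expWeight (strongCoef h N k • derivForm (L : ℝ) k (diffIndex d Mord)
        (boxDensity (boxRad R L k) (boxWt (L : ℝ) d k) (blockOf (L ^ k) x))))
      (fun ψ : (Fin d → ZMod M) → ℝ =>
        (expNegH H₁ (blockOf (L ^ k) x) ψ - expNegH H₂ (blockOf (L ^ k) x) ψ) *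
          (expNegH H₃ (blockOf (L ^ k) x) ψ - 1))
      (256 * Real.exp (1 / 4) *
        hamNorm (fieldWt h (L : ℝ) d k) ((L : ℝ) ^ k) (blockOf (L ^ k) x).card (H₁ - H₂) *
        hamNorm (fieldWt h (L : ℝ) d k) ((L : ℝ) ^ k) (blockOf (L ^ k) x).card H₃) := by
  have hL0 : (0 : ℝ) < L := by exact_mod_cast hLodd.pos
  exact tayNormLE_cexp_neg_eval_sub_mul_sub_one (fieldWt_pos hh hL0 d k) (by positivity) hp hBS
    (ell2Dominates_strongWeight_abkm (R := R) hd hLodd hM hk hh hMord x) r₀ hH₁ hH₂ hH₃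

end Literature.MathematicalPhysics.StatisticalMechanics.GradientRG

end
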